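import Summits.Ventures.CertifiedManyBodySolver.Rows.DopedTLCorrWindow

/-!
# Thermodynamic-limit correlator rows over a PARAMETER BOX of the `t–t'` square lattice with an energy
# WINDOW given by two FUNCTIONS on the box (floor `flo ≤ e₀` and cap `e₀ ≤ cap`): M3′ BOX window cells

HONEST FRAMING: first certified bounds; not a superconductivity verdict; every number certified or
labelled float. NOTHING IS ASSERTED HERE: every bound-valued statement is a `def … : Prop` or takes row
predicates as hypotheses; no `sorry`, no new axiom, no named fact; zero compute.

WHAT THIS FILE IS (cell hubbard-algo, seat hubbard-box-eng-3 = the box-dual certificate format `boxdual/0`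
and its exact reader; stage S2 "points → boxes", D-0096/D-0097). Companion of `Rows/DopedTLCorrWindow.lean`
(hubbard-obs-p1: the two-row POINT predicates `SquareTTPrimeCorrLowerRowW tp U n lo hi r Λ X`, hypotheses
`lo ≤ energyDensityTT' 1 tp U n ≤ hi` with rational slots) and of `Rows/DopedTLCorrBox.lean` (this seat:
one-row BOX predicates, cap function only). A `boxdual/0` bundle over a cell `Set.Icc lo hi` of parameter
space — router coordinate order `θ = (U, t', n)`, `θ 0 = U`, `θ 1 = t'`, `θ 2 = n`, as in
`forall_groundStates_le_of_gridCells₃` (`Literature/…/HubbardTTPrimeBoxWordCovering`) — whose vertex programs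
carry an energy CAP row (declared plane / density chord, `BOXDUAL-FORMAT.md` §1, §11, §16) AND energy FLOOR
rows (registry cuts transported to the cell by the producer: `cuts[].literal_per_vertex`, affine in the
density, §11) certifies, for every `θ` of the cell and every torus-limit ground state there whose energy
density lies in the window `flo θ ≤ e₀(θ) ≤ cap θ`, the word `r ≤ Re ω(X)` (resp. `Re ω(X) ≤ r`, resp. the
`D₄`-orbit mean). Several floor rows are ONE floor function (their pointwise `max`). The validity of the window
functions on the cell (`flo ≤ e₀ ≤ cap` there) is the producer's cited transport device and is NOT part of
the row. This file types

* §A the BOX WINDOW ROW PREDICATES `SquareTTPrimeCorrLowerBoxRowW / UpperBoxRowW / OrbitLowerBoxRowW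
  lo hi flo cap r …` (+ the docc cells), binder lists VERBATIM those of the point rows with
  `(tp, U, n) := (θ 1, θ 0, θ 2)`;
* §B the solver-free edges: upper ⟷ lower on `−X`; monotonicity (sub-box, HIGHER floor, LOWER cap — a row
  survives any narrower window —, slot); the POINT two-row predicate at any point of the box whose rational
  window contains the functional window there (`….at_point`); box rows FROM point rows; the COVERING rule
  (union word of a grid read); the UNCONDITIONAL shape once floor and cap are discharged on the box
  (literally the per-cell hypothesis `hcell` of `forall_groundStates_le_of_gridCells₃`); orbit rows at
  `S = {1}`; NON-VACUITY ⇒ slot consistency.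

Rows are instantiated only under `Certificates/` (claim nodes of `boxdual/0` words of record).
-/

noncomputable section

namespace Summit.Ventures.CertifiedManyBodySolver

open Literature.MathematicalPhysics.QuantumLattice
open Matrix HubbardWave0 Literature.Probability.LatticeModels ThermodynamicLimit Filter Topology
open scoped BigOperators

/-! ## §A  BOX window rows of the `t–t'` square lattice (`t = 1`; box coordinates `θ = (U, t', n)`) -/

section Defs

/-- §A (LOWER form, energy WINDOW on a box). Box `Set.Icc lo hi` of couplings `θ = (U, t', n)`
(`θ 0 = U`, `θ 1 = t'`, `θ 2 = n`), floor and cap functions `flo`, `cap` on the box: for EVERY `θ` of the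
box, every torus limit `ω` of unit ground states `ψ` of the sectors `(rectN n L_j, S^z = 0)` of
`hubbardTorusTT' L_j 1 t' U` along `L_j → ∞`, GIVEN `flo θ ≤ energyDensityTT' 1 t' U n ≤ cap θ`, the window
observable `X` on the finite support `Λ` has `r ≤ Re ω(X)`. Per point this is `SquareTTPrimeCorrLowerRowW`
with the rational window replaced by `[flo θ, cap θ]`. -/
def SquareTTPrimeCorrLowerBoxRowW (lo hi : Fin 3 → ℝ) (flo cap : (Fin 3 → ℝ) → ℝ) (r : ℚ)
    (Λ : Finset (Site 2)) (X : FermionOp Λ) : Prop :=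
  ∀ θ ∈ Set.Icc lo hi, ∀ (ω : InfVolFermionState 2) (Ls : ℕ → ℕ) (ψ : ∀ L, Fock (Orb (FermionTorus 2 L))),
    Tendsto Ls atTop atTop →
    (∀ j, IsGroundStateInSector (hubbardTorusTT' (Ls j) 1 (θ 1) (θ 0)) (rectN (θ 2) (Ls j)) 0 (ψ (Ls j))) →
    (∀ j, star (ψ (Ls j)) ⬝ᵥ ψ (Ls j) = 1) → ω.IsTorusLimitOf ψ Ls →
    flo θ ≤ energyDensityTT' 1 (θ 1) (θ 0) (θ 2) → energyDensityTT' 1 (θ 1) (θ 0) (θ 2) ≤ cap θ →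
    ((r : ℚ) : ℝ) ≤ (ω.expect Λ X).re

/-- §A (UPPER form, energy WINDOW on a box): same box, state class and window hypothesis, conclusion
`Re ω(X) ≤ r`. -/
def SquareTTPrimeCorrUpperBoxRowW (lo hi : Fin 3 → ℝ) (flo cap : (Fin 3 → ℝ) → ℝ) (r : ℚ)
    (Λ : Finset (Site 2)) (X : FermionOp Λ) : Prop :=
  ∀ θ ∈ Set.Icc lo hi, ∀ (ω : InfVolFermionState 2) (Ls : ℕ → ℕ) (ψ : ∀ L, Fock (Orb (FermionTorus 2 L))),
    Tendsto Ls atTop atTop →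
    (∀ j, IsGroundStateInSector (hubbardTorusTT' (Ls j) 1 (θ 1) (θ 0)) (rectN (θ 2) (Ls j)) 0 (ψ (Ls j))) →
    (∀ j, star (ψ (Ls j)) ⬝ᵥ ψ (Ls j) = 1) → ω.IsTorusLimitOf ψ Ls →
    flo θ ≤ energyDensityTT' 1 (θ 1) (θ 0) (θ 2) → energyDensityTT' 1 (θ 1) (θ 0) (θ 2) ≤ cap θ →
    (ω.expect Λ X).re ≤ ((r : ℚ) : ℝ)

/-- §A (`D₄`-ORBIT-MEAN form, energy WINDOW on a box; the honest conclusion of a point-group-reduced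
certificate): same box, state class and window hypothesis, conclusion
`r ≤ |S|⁻¹ Σ_{γ ∈ S} Re ω_{γΛ}(Γ(d4Emb γ 0) X)`. -/
def SquareTTPrimeCorrOrbitLowerBoxRowW (lo hi : Fin 3 → ℝ) (flo cap : (Fin 3 → ℝ) → ℝ) (r : ℚ)
    (S : Finset (DihedralGroup 4)) (Λ : Finset (Site 2)) (X : FermionOp Λ) : Prop :=
  ∀ θ ∈ Set.Icc lo hi, ∀ (ω : InfVolFermionState 2) (Ls : ℕ → ℕ) (ψ : ∀ L, Fock (Orb (FermionTorus 2 L))),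
    Tendsto Ls atTop atTop →
    (∀ j, IsGroundStateInSector (hubbardTorusTT' (Ls j) 1 (θ 1) (θ 0)) (rectN (θ 2) (Ls j)) 0 (ψ (Ls j))) →
    (∀ j, star (ψ (Ls j)) ⬝ᵥ ψ (Ls j) = 1) → ω.IsTorusLimitOf ψ Ls →
    flo θ ≤ energyDensityTT' 1 (θ 1) (θ 0) (θ 2) → energyDensityTT' 1 (θ 1) (θ 0) (θ 2) ≤ cap θ →
    ((r : ℚ) : ℝ) ≤ (S.card : ℝ)⁻¹ *
      ∑ g ∈ S, (ω.expect (d4ShiftSet g 0 Λ) (fermionEmbed (PolySite.d4Emb g 0 Λ) X)).re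

/-- M3′ BOX double-occupancy LOWER window cell: `r ≤ Re ω(n_{0↑}n_{0↓})` on the box given
`flo ≤ e₀ ≤ cap`. -/
def SquareTTPrimeDoccLowerBoxRowW (lo hi : Fin 3 → ℝ) (flo cap : (Fin 3 → ℝ) → ℝ) (r : ℚ) : Prop :=
  SquareTTPrimeCorrLowerBoxRowW lo hi flo cap r {0} (doccAt0 2)

/-- M3′ BOX double-occupancy UPPER window cell: `Re ω(n_{0↑}n_{0↓}) ≤ r` on the box given
`flo ≤ e₀ ≤ cap`. -/
def SquareTTPrimeDoccUpperBoxRowW (lo hi : Fin 3 → ℝ) (flo cap : (Fin 3 → ℝ) → ℝ) (r : ℚ) : Prop :=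
  SquareTTPrimeCorrUpperBoxRowW lo hi flo cap r {0} (doccAt0 2)

end Defs

/-! ## §B  Solver-free edges -/

section Edges

variable {lo hi lo' hi' : Fin 3 → ℝ} {flo flo' cap cap' : (Fin 3 → ℝ) → ℝ} {elo ehi r r' : ℚ}
  {Λ : Finset (Site 2)} {X : FermionOp Λ}

/-- UPPER box window rows from LOWER ones on the negated objective: `−r ≤ Re ω(−X)` is `Re ω(X) ≤ r`. -/
theorem SquareTTPrimeCorrUpperBoxRowW.of_lower_neg
    (h : SquareTTPrimeCorrLowerBoxRowW lo hi flo cap (-r) Λ (-X)) :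
    SquareTTPrimeCorrUpperBoxRowW lo hi flo cap r Λ X := by
  intro θ hθ ω Ls ψ hLs hψ hψ1 hω hflo hcap
  have hh := h θ hθ ω Ls ψ hLs hψ hψ1 hω hflo hcap
  rw [map_neg, Complex.neg_re] at hh
  push_cast at hh
  linarith

/-- LOWER box window rows from UPPER ones on the negated objective. -/
theorem SquareTTPrimeCorrLowerBoxRowW.of_upper_neg
    (h : SquareTTPrimeCorrUpperBoxRowW lo hi flo cap (-r) Λ (-X)) :
    SquareTTPrimeCorrLowerBoxRowW lo hi flo cap r Λ X := by
  intro θ hθ ω Ls ψ hLs hψ hψ1 hω hflo hcap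
  have hh := h θ hθ ω Ls ψ hLs hψ hψ1 hω hflo hcap
  rw [map_neg, Complex.neg_re] at hh
  push_cast at hh
  linarith

/-- MONOTONICITY of a lower box window row: it survives a SUB-BOX (`lo ≤ lo'`, `hi' ≤ hi`), any NARROWER
window on that sub-box (HIGHER floor `flo ≤ flo'`, LOWER cap `cap' ≤ cap` — fewer states qualify; the
logical half of the cap-override sentence of `BOXDUAL-FORMAT.md` §16) and a SMALLER slot `r' ≤ r`. -/
theorem SquareTTPrimeCorrLowerBoxRowW.mono (h : SquareTTPrimeCorrLowerBoxRowW lo hi flo cap r Λ X)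
    (hlo : lo ≤ lo') (hhi : hi' ≤ hi) (hflo : ∀ θ ∈ Set.Icc lo' hi', flo θ ≤ flo' θ)
    (hcap : ∀ θ ∈ Set.Icc lo' hi', cap' θ ≤ cap θ) (hr : r' ≤ r) :
    SquareTTPrimeCorrLowerBoxRowW lo' hi' flo' cap' r' Λ X := by
  intro θ hθ ω Ls ψ hLs hψ hψ1 hω hf hc
  have hθ' : θ ∈ Set.Icc lo hi := ⟨hlo.trans hθ.1, hθ.2.trans hhi⟩
  have hh := h θ hθ' ω Ls ψ hLs hψ hψ1 hω ((hflo θ hθ).trans hf) (hc.trans (hcap θ hθ))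
  exact le_trans (by exact_mod_cast hr) hh

/-- MONOTONICITY of an upper box window row: sub-box, narrower window, LARGER slot `r ≤ r'`. -/
theorem SquareTTPrimeCorrUpperBoxRowW.mono (h : SquareTTPrimeCorrUpperBoxRowW lo hi flo cap r Λ X)
    (hlo : lo ≤ lo') (hhi : hi' ≤ hi) (hflo : ∀ θ ∈ Set.Icc lo' hi', flo θ ≤ flo' θ)
    (hcap : ∀ θ ∈ Set.Icc lo' hi', cap' θ ≤ cap θ) (hr : r ≤ r') :
    SquareTTPrimeCorrUpperBoxRowW lo' hi' flo' cap' r' Λ X := by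
  intro θ hθ ω Ls ψ hLs hψ hψ1 hω hf hc
  have hθ' : θ ∈ Set.Icc lo hi := ⟨hlo.trans hθ.1, hθ.2.trans hhi⟩
  have hh := h θ hθ' ω Ls ψ hLs hψ hψ1 hω ((hflo θ hθ).trans hf) (hc.trans (hcap θ hθ))
  exact hh.trans (by exact_mod_cast hr)

/-- The POINT two-row predicate at any point `θ` of the box whose rational window `[elo, ehi]` lies inside
the functional window there (`flo θ ≤ elo`, `ehi ≤ cap θ`):
`SquareTTPrimeCorrLowerRowW (θ 1) (θ 0) (θ 2) elo ehi r Λ X` (at `θ = (8, tp, 7/8)` an `M3CorrLowerRowW`). -/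
theorem SquareTTPrimeCorrLowerBoxRowW.at_point (h : SquareTTPrimeCorrLowerBoxRowW lo hi flo cap r Λ X)
    {θ : Fin 3 → ℝ} (hθ : θ ∈ Set.Icc lo hi) (helo : flo θ ≤ ((elo : ℚ) : ℝ))
    (hehi : ((ehi : ℚ) : ℝ) ≤ cap θ) :
    SquareTTPrimeCorrLowerRowW (θ 1) (θ 0) (θ 2) elo ehi r Λ X :=
  fun ω Ls ψ hLs hψ hψ1 hω hl hu => h θ hθ ω Ls ψ hLs hψ hψ1 hω (helo.trans hl) (hu.trans hehi)

/-- The point two-row UPPER predicate at any point of the box whose rational window lies inside the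
functional window there. -/
theorem SquareTTPrimeCorrUpperBoxRowW.at_point (h : SquareTTPrimeCorrUpperBoxRowW lo hi flo cap r Λ X)
    {θ : Fin 3 → ℝ} (hθ : θ ∈ Set.Icc lo hi) (helo : flo θ ≤ ((elo : ℚ) : ℝ))
    (hehi : ((ehi : ℚ) : ℝ) ≤ cap θ) :
    SquareTTPrimeCorrUpperRowW (θ 1) (θ 0) (θ 2) elo ehi r Λ X :=
  fun ω Ls ψ hLs hψ hψ1 hω hl hu => h θ hθ ω Ls ψ hLs hψ hψ1 hω (helo.trans hl) (hu.trans hehi)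

/-- A box window row FROM point two-row predicates: if at every point of the box some rational window
`[eloθ θ, ehiθ θ] ⊇ [flo θ, cap θ]` carries the point lower predicate with the common slot `r`, the box row
holds (a family of point certificates under uniform window devices; not the `boxdual/0` mechanism). -/
theorem SquareTTPrimeCorrLowerBoxRowW.of_forall_points (eloθ ehiθ : (Fin 3 → ℝ) → ℚ)
    (hflo : ∀ θ ∈ Set.Icc lo hi, ((eloθ θ : ℚ) : ℝ) ≤ flo θ)
    (hcap : ∀ θ ∈ Set.Icc lo hi, cap θ ≤ ((ehiθ θ : ℚ) : ℝ))
    (h : ∀ θ ∈ Set.Icc lo hi, SquareTTPrimeCorrLowerRowW (θ 1) (θ 0) (θ 2) (eloθ θ) (ehiθ θ) r Λ X) :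
    SquareTTPrimeCorrLowerBoxRowW lo hi flo cap r Λ X :=
  fun θ hθ ω Ls ψ hLs hψ hψ1 hω hl hu =>
    h θ hθ ω Ls ψ hLs hψ hψ1 hω ((hflo θ hθ).trans hl) (hu.trans (hcap θ hθ))

/-- COVERING RULE (the UNION word of a grid read; Neumaier, *Acta Numerica* 13 (2004) §12 (12.2)–(12.3)).
Finitely many certified boxes `Set.Icc (los i) (his i)` with windows `[flos i, caps i]` and slots `rs i`;
every point `θ` of the target box lies in one of them whose window CONTAINS the target window at `θ`
(`flos i θ ≤ flo θ`, `cap θ ≤ caps i θ` — e.g. equal: the cells of one grid product carry continuous cap and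
cut functions); then any slot `r ≤ rs i` (all `i`) is a lower box window row on the target box. -/
theorem SquareTTPrimeCorrLowerBoxRowW.of_cover {ι : Type*} (I : Finset ι) (los his : ι → Fin 3 → ℝ)
    (flos caps : ι → (Fin 3 → ℝ) → ℝ) (rs : ι → ℚ)
    (hrows : ∀ i ∈ I, SquareTTPrimeCorrLowerBoxRowW (los i) (his i) (flos i) (caps i) (rs i) Λ X)
    (hcov : ∀ θ ∈ Set.Icc lo hi, ∃ i ∈ I, θ ∈ Set.Icc (los i) (his i) ∧ flos i θ ≤ flo θ ∧ cap θ ≤ caps i θ)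
    (hr : ∀ i ∈ I, r ≤ rs i) : SquareTTPrimeCorrLowerBoxRowW lo hi flo cap r Λ X := by
  intro θ hθ ω Ls ψ hLs hψ hψ1 hω hl hu
  obtain ⟨i, hi, hθi, hfi, hci⟩ := hcov θ hθ
  have hh := hrows i hi θ hθi ω Ls ψ hLs hψ hψ1 hω (hfi.trans hl) (hu.trans hci)
  exact le_trans (by exact_mod_cast hr i hi) hh

/-- COVERING RULE for upper box window rows (slot `rs i ≤ r` for all `i`). -/
theorem SquareTTPrimeCorrUpperBoxRowW.of_cover {ι : Type*} (I : Finset ι) (los his : ι → Fin 3 → ℝ)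
    (flos caps : ι → (Fin 3 → ℝ) → ℝ) (rs : ι → ℚ)
    (hrows : ∀ i ∈ I, SquareTTPrimeCorrUpperBoxRowW (los i) (his i) (flos i) (caps i) (rs i) Λ X)
    (hcov : ∀ θ ∈ Set.Icc lo hi, ∃ i ∈ I, θ ∈ Set.Icc (los i) (his i) ∧ flos i θ ≤ flo θ ∧ cap θ ≤ caps i θ)
    (hr : ∀ i ∈ I, rs i ≤ r) : SquareTTPrimeCorrUpperBoxRowW lo hi flo cap r Λ X := by
  intro θ hθ ω Ls ψ hLs hψ hψ1 hω hl hu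
  obtain ⟨i, hi, hθi, hfi, hci⟩ := hcov θ hθ
  have hh := hrows i hi θ hθi ω Ls ψ hLs hψ hψ1 hω (hfi.trans hl) (hu.trans hci)
  exact hh.trans (by exact_mod_cast hr i hi)

/-- UNCONDITIONAL SHAPE: once floor AND cap are DISCHARGED on the box (`flo θ ≤ e₀(θ) ≤ cap θ` for every
`θ` of the box — the producer's transport devices), a lower box window row bounds `Re ω(X)` for EVERY state of
the class at EVERY point of the box — literally the per-cell hypothesis `hcell` of
`forall_groundStates_le_of_gridCells₃` (with `obs ω = Re ω(X)`, `Fl = r`). -/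
theorem SquareTTPrimeCorrLowerBoxRowW.uncond (h : SquareTTPrimeCorrLowerBoxRowW lo hi flo cap r Λ X)
    (hflo : ∀ θ ∈ Set.Icc lo hi, flo θ ≤ energyDensityTT' 1 (θ 1) (θ 0) (θ 2))
    (hcap : ∀ θ ∈ Set.Icc lo hi, energyDensityTT' 1 (θ 1) (θ 0) (θ 2) ≤ cap θ) :
    ∀ θ ∈ Set.Icc lo hi, ∀ (ω : InfVolFermionState 2) (Ls : ℕ → ℕ) (ψ : ∀ L, Fock (Orb (FermionTorus 2 L))),
      Tendsto Ls atTop atTop →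
      (∀ j, IsGroundStateInSector (hubbardTorusTT' (Ls j) 1 (θ 1) (θ 0)) (rectN (θ 2) (Ls j)) 0 (ψ (Ls j))) →
      (∀ j, star (ψ (Ls j)) ⬝ᵥ ψ (Ls j) = 1) → ω.IsTorusLimitOf ψ Ls →
      ((r : ℚ) : ℝ) ≤ (ω.expect Λ X).re :=
  fun θ hθ ω Ls ψ hLs hψ hψ1 hω => h θ hθ ω Ls ψ hLs hψ hψ1 hω (hflo θ hθ) (hcap θ hθ)

/-- UNCONDITIONAL SHAPE of an upper box window row once floor and cap are discharged on the box. -/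
theorem SquareTTPrimeCorrUpperBoxRowW.uncond (h : SquareTTPrimeCorrUpperBoxRowW lo hi flo cap r Λ X)
    (hflo : ∀ θ ∈ Set.Icc lo hi, flo θ ≤ energyDensityTT' 1 (θ 1) (θ 0) (θ 2))
    (hcap : ∀ θ ∈ Set.Icc lo hi, energyDensityTT' 1 (θ 1) (θ 0) (θ 2) ≤ cap θ) :
    ∀ θ ∈ Set.Icc lo hi, ∀ (ω : InfVolFermionState 2) (Ls : ℕ → ℕ) (ψ : ∀ L, Fock (Orb (FermionTorus 2 L))),
      Tendsto Ls atTop atTop →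
      (∀ j, IsGroundStateInSector (hubbardTorusTT' (Ls j) 1 (θ 1) (θ 0)) (rectN (θ 2) (Ls j)) 0 (ψ (Ls j))) →
      (∀ j, star (ψ (Ls j)) ⬝ᵥ ψ (Ls j) = 1) → ω.IsTorusLimitOf ψ Ls →
      (ω.expect Λ X).re ≤ ((r : ℚ) : ℝ) :=
  fun θ hθ ω Ls ψ hLs hψ hψ1 hω => h θ hθ ω Ls ψ hLs hψ hψ1 hω (hflo θ hθ) (hcap θ hθ)

/-- The `D₄`-orbit box window row at the TRIVIAL label set `S = {1}` IS the plain lower box window row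
(`InfVolFermionState.expect_fermionEmbed_d4Emb_one_zero`). -/
theorem squareTTPrimeCorrOrbitLowerBoxRowW_singleton_one_iff :
    SquareTTPrimeCorrOrbitLowerBoxRowW lo hi flo cap r {1} Λ X ↔
      SquareTTPrimeCorrLowerBoxRowW lo hi flo cap r Λ X := by
  unfold SquareTTPrimeCorrOrbitLowerBoxRowW SquareTTPrimeCorrLowerBoxRowW
  simp only [Finset.sum_singleton, Finset.card_singleton, Nat.cast_one, inv_one, one_mul,
    InfVolFermionState.expect_fermionEmbed_d4Emb_one_zero]

/-- NON-VACUITY ⇒ CONSISTENCY OF THE SLOTS on a box: if some point `θ` of the box has a density in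
`[0, 2]` and its energy lies in the window there, the state class at `θ` is inhabited
(`exists_isTorusLimitOf_sectorGroundState_TT'`), so a typed LOWER box slot never exceeds a typed UPPER box
slot on the same objective. -/
theorem SquareTTPrimeCorrLowerBoxRowW.le_of_upperBoxRowW
    (hl : SquareTTPrimeCorrLowerBoxRowW lo hi flo cap r Λ X)
    (hu' : SquareTTPrimeCorrUpperBoxRowW lo hi flo cap r' Λ X) {θ : Fin 3 → ℝ} (hθ : θ ∈ Set.Icc lo hi)
    (hn0 : 0 ≤ θ 2) (hn2 : θ 2 ≤ 2) (hef : flo θ ≤ energyDensityTT' 1 (θ 1) (θ 0) (θ 2))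
    (hec : energyDensityTT' 1 (θ 1) (θ 0) (θ 2) ≤ cap θ) : r ≤ r' := by
  obtain ⟨ψ, φ, ω, hφ, hψ, hψ1, hω, -, -, -⟩ :=
    exists_isTorusLimitOf_sectorGroundState_TT' 1 (θ 1) (θ 0) hn0 hn2 (Ls := id) tendsto_id
  have hLs : Tendsto (id ∘ φ) atTop atTop := hφ.tendsto_atTop
  have h1 := hl θ hθ ω (id ∘ φ) ψ hLs (fun j => hψ _) (fun j => hψ1 _) hω hef hec
  have h2 := hu' θ hθ ω (id ∘ φ) ψ hLs (fun j => hψ _) (fun j => hψ1 _) hω hef hec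
  exact_mod_cast h1.trans h2

end Edges

end Summit.Ventures.CertifiedManyBodySolver

end
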